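import Literature.Geometry.DiscreteGeometry.EnergyLinearProgrammingBound

/-!
# Sharp LP bound for the inverse-square energy of 275 points on S²¹ (McLaughlin)

Framing: lottery ticket; floor = certified bounds/negative ranges. Venture `PackingBounds` (cell
`pub-packcert`, seat `pub-packcert-energy`), energy-minimisation family, **+ control**.

**Theorem.** Every `275`-point configuration `C ⊂ S^21` of unit vectors of `ℝ^22` has `Σ_{x ≠ y ∈
C} |x - y|^(-2) ≥ 39050` (ordered pairs, the convention of Cohn–Kumar 2007). The bound is SHARP:
`39050` is the exact `|x-y|^(-2)`-energy of the McLaughlin configuration (275 points in S²¹)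
(inner products `-1/4, 1/6` with multiplicities `[112, 162]` seen from each point), which is
universally optimal by Cohn–Kumar 2007, Thm. 1.2; that equality is checked in exact rational
arithmetic in the cell's pipeline (`code/energy_cert.py`, verifier `code/energy_verify_a.py`), not
in this file.

Proof: the linear programming bound for energy
(`Literature.Geometry.DiscreteGeometry.EnergyLP.energy_ge`, Yudin 1992 / Cohn–Kumar 2007 Prop.
4.1) applied to the Hermite-interpolation certificate `h = Σ_k α_k C_k^(10)` of degree `3` with `α
= (144/275, 7/250, 84/34375, 9/34375)`, all `≥ 0`, and the kernel-checked polynomial identity `1 -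
(2 - 2t) h(t) = 576/625 · W(t)` with `W(t) = (t + 1 / 4) ^ 2 * (t - 1 / 6) ^ 2` manifestly `≥ 0`
on `[-1, 1]`, so that `h(t) ≤ (2 - 2t)^(-1) = |x - y|^(-2)` at `t = ⟨x, y⟩ ∈ [-1, 1)`; finally
`275² α_0 - 275 h(1) = 39050` exactly.

## References
* H. Cohn, A. Kumar, *Universally optimal distribution of points on spheres*, J. Amer. Math. Soc.
20 (2007) 99–148, Thm. 1.2, Prop. 4.1, §§5–6. [`CohnKumar2006`]
* V. A. Yudin, Discrete Math. Appl. 3 (1993) 75–81. [`Yudin1993`]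
-/

namespace Summit.Ventures.PackingBounds.Energy

open Finset Literature.Analysis.SpecialFunctions Literature.Geometry.DiscreteGeometry

open scoped Classical in
/-- **Sharp LP lower bound for the `|x-y|^(-2)`-energy of `275` points on `S^21`**: `Σ_{x ≠ y} |x
- y|^(-2) ≥ 39050`, attained by the McLaughlin configuration (275 points in S²¹). Certificate:
Hermite interpolant of `t ↦ (2-2t)^(-1)` at the inner products of the configuration, degree
`3`, nonnegative Gegenbauer coefficients (Cohn–Kumar 2007 §§5–6). [cite: CohnKumar2006,
Theorem 1.2 and Proposition 4.1] -/
theorem riesz2_energy_card275_ge (C : Finset (EuclideanSpace ℝ (Fin 22)))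
    (h1 : ∀ x ∈ C, ‖x‖ = 1) (hN : C.card = 275) :
    (39050 : ℝ) ≤ ∑ x ∈ C, ∑ y ∈ C.erase x, (‖x - y‖ ^ 2)⁻¹ := by
  have hα : ∀ k : ℕ, (0 : ℝ) ≤ (fun k => match k with
        | 0 => 144 / 275 | 1 => 7 / 250 | 2 => 84 / 34375
        | 3 => 9 / 34375 | _ => 0) k := by
    intro k
    dsimp only
    split <;> norm_num
  have hH : ∀ t : ℝ, -1 ≤ t → t < 1 →
      ∑ k ∈ range (3 + 1), (fun k => match k with
        | 0 => 144 / 275 | 1 => 7 / 250 | 2 => 84 / 34375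
        | 3 => 9 / 34375 | _ => 0) k * gegenbauerSum (10 : ℝ) k t ≤
        (fun r : ℝ => r⁻¹) (2 - 2 * t) := by
    intro t ht1 ht2
    have hsum : ∑ k ∈ range (3 + 1), (fun k => match k with
        | 0 => 144 / 275 | 1 => 7 / 250 | 2 => 84 / 34375
        | 3 => 9 / 34375 | _ => 0) k * gegenbauerSum (10 : ℝ) k t =
        312 / 625 + 314 / 625 * t + 336 / 625 * t ^ 2
          + 288 / 625 * t ^ 3 := by
      simp [Finset.sum_range_succ, gegenbauerSum, gegenbauerCoeff, Finset.prod_range_succ,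
        Nat.factorial]
      ring
    rw [hsum]
    have hpos : (0 : ℝ) < 2 - 2 * t := by linarith
    have ht0 : (0 : ℝ) ≤ t + 1 := by linarith
    show _ ≤ (2 - 2 * t)⁻¹
    rw [inv_eq_one_div, le_div_iff₀ hpos]
    have hid : (312 / 625 + 314 / 625 * t + 336 / 625 * t ^ 2
          + 288 / 625 * t ^ 3) * (2 - 2 * t) =
        1 - 576 / 625 *
          ((t + 1 / 4) ^ 2 * (t - 1 / 6) ^ 2) := by
      ring
    have hW : (0 : ℝ) ≤
          (t + 1 / 4) ^ 2 * (t - 1 / 6) ^ 2 :=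
      (mul_nonneg (sq_nonneg (t + 1 / 4))
        (sq_nonneg (t - 1 / 6)))
    rw [hid]
    nlinarith [hW, ht0]
  have key := EnergyLP.energy_ge (n := 22) (μ := 10) (by norm_num) (by norm_num) 3
    (fun k => match k with
        | 0 => 144 / 275 | 1 => 7 / 250 | 2 => 84 / 34375
        | 3 => 9 / 34375 | _ => 0) hα (fun r : ℝ => r⁻¹) hH C h1
  rw [hN] at key
  refine le_trans (le_of_eq ?_) key
  norm_num [Finset.sum_range_succ, gegenbauerSum, gegenbauerCoeff, Finset.prod_range_succ,
    Nat.factorial]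

end Summit.Ventures.PackingBounds.Energy
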